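import Summits.QuantumFields.YangMills.Theorems.PoincareLipschitzSobolevInversionLetters
import Literature.Analysis.FunctionSpaces.SobolevDomainProofs
import HarnessLib

/-!
# Sobolev transport under the planar inversion, off the pole (ROAD (W), brick W-INV, part 2)

Helper file (K2 lane of crux `stmt-QuantumFields-19936` `HistoryTailL` ∕ crux `stmt-QuantumFields-23533`
`BlockLipschitzL`, LINE 25 «CompactnessTransfer», ROAD (W) «the H-system energy gap at `3π` from the
sharp two-point Wente bound», brick W-INV).  YM₃ on the unit 3-torus is rung R3 of the ladder — NOT
`d = 4`, NOT infinite volume, NOT a mass gap, NOT the Clay problem; nothing here bears on those.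

`M = EuclideanGeometry.inversion c 1` on `E² = EuclideanSpace ℝ (Fin 2)`.  Main results:

* §1 test functions through the inversion: for a test function `θ` on `{c}ᶜ` (lit
  `IsTestFunctionOn`), `θ ∘ M` is again a test function on `{c}ᶜ`, and so is `ω · (θ ∘ M)` for any
  `ω` smooth off the pole;
* §2 **the weak chain rule** `hasWeakFDerivOn_comp_inversion`: if `u` has the weak derivative `Gu`
  on `{c}ᶜ`, then `u ∘ M` has the weak derivative `y ↦ Gu (M y) ∘L DM(y)` on `{c}ᶜ`.  Proof: test-side
  change of variables (part 1, `integral_comp_inversion'`), the involution identities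
  `DM(x) (DM(M x) v) = v`, `‖x−c‖⁻⁴ • DM(M x) = DM(x)`, and the PIOLA∕harmonicity identity of part 1
  (`sum_fderiv_inversionField_coord_eq_zero`): the `x`-dependent direction `DM(x) v` produced by the
  change of variables is divergence free, so the weak derivative of `u` can be tested against
  `(DM(·) v)ᵢ · (θ ∘ M)` coordinate by coordinate with no zeroth-order remainder.

References: H. Brezis, J.-M. Coron, Arch. Rational Mech. Anal. 89 (1985), Appendix p. 48;
L. C. Evans, *PDE* (2010), §5.2.1, §C.4.
-/

noncomputable section

open MeasureTheory Set Filter Metric Module EuclideanGeometry TopologicalSpace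
open scoped ENNReal Topology RealInnerProductSpace ContDiff

namespace Summit.QuantumFields.YangMills.Theorems.PoincareLipschitzSobolevInversion

open Literature.Analysis.FunctionSpaces

/-! ## §1 Test functions through the inversion -/

/-- A test function on `{c}ᶜ` vanishes near `c` and far from `c`. [folklore] -/
theorem exists_radii_of_isTestFunctionOn {c : EuclideanSpace ℝ (Fin 2)} {θ : EuclideanSpace ℝ (Fin 2) → ℝ}
    (hθ : IsTestFunctionOn ⟨{c}ᶜ, isOpen_compl_singleton⟩ θ) :
    ∃ δ R : ℝ, 0 < δ ∧ 0 < R ∧ (∀ y, dist y c < δ → θ y = 0) ∧ ∀ y, R < dist y c → θ y = 0 := by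
  -- near `c`: `c ∉ tsupport θ`, which is closed
  have hc : c ∉ tsupport θ := fun h => hθ.tsupport_subset h rfl
  obtain ⟨δ, hδ, hball⟩ := Metric.isOpen_iff.1 (isClosed_tsupport θ).isOpen_compl c hc
  -- far from `c`: compact support
  obtain ⟨R, hR⟩ := (isBounded_iff_subset_closedBall c).1 hθ.hasCompactSupport.isCompact.isBounded
  refine ⟨δ, max R 0 + 1, hδ, by positivity, fun y hy => ?_, fun y hy => ?_⟩
  · exact image_eq_zero_of_notMem_tsupport (hball (mem_ball.2 hy))
  · refine image_eq_zero_of_notMem_tsupport fun h => ?_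
    have := hR h
    rw [mem_closedBall] at this
    linarith [le_max_left R 0]

/-- `θ ∘ M` vanishes on a neighbourhood of the pole. [folklore] -/
theorem comp_inversion_eq_zero_near {c : EuclideanSpace ℝ (Fin 2)} {θ : EuclideanSpace ℝ (Fin 2) → ℝ}
    (hθ : IsTestFunctionOn ⟨{c}ᶜ, isOpen_compl_singleton⟩ θ) :
    ∃ ε : ℝ, 0 < ε ∧ ∀ x, dist x c < ε → θ (inversion c 1 x) = 0 := by
  obtain ⟨δ, R, hδ, hR, hnear, hfar⟩ := exists_radii_of_isTestFunctionOn hθ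
  refine ⟨R⁻¹, inv_pos.2 hR, fun x hx => ?_⟩
  by_cases hxc : x = c
  · subst hxc
    rw [inversion_self]
    exact hnear _ (by simpa using hδ)
  · refine hfar _ ?_
    rw [dist_inversion_center, one_pow, one_div]
    have hpos : 0 < dist x c := dist_pos.2 hxc
    rwa [lt_inv_comm₀ hR hpos]

/-- `θ ∘ M` vanishes outside a ball about the pole. [folklore] -/
theorem comp_inversion_eq_zero_far {c : EuclideanSpace ℝ (Fin 2)} {θ : EuclideanSpace ℝ (Fin 2) → ℝ}
    (hθ : IsTestFunctionOn ⟨{c}ᶜ, isOpen_compl_singleton⟩ θ) :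
    ∃ R : ℝ, 0 < R ∧ ∀ x, R < dist x c → θ (inversion c 1 x) = 0 := by
  obtain ⟨δ, R, hδ, hR, hnear, hfar⟩ := exists_radii_of_isTestFunctionOn hθ
  refine ⟨δ⁻¹, inv_pos.2 hδ, fun x hx => hnear _ ?_⟩
  have hpos : 0 < dist x c := (inv_pos.2 hδ).trans hx
  rw [dist_inversion_center, one_pow, one_div]
  rwa [inv_lt_comm₀ hpos hδ]

/-- **Test functions transport**: for a test function `θ` on `{c}ᶜ`, `θ ∘ M` is a test function on
`{c}ᶜ` (smooth off the pole by the chain rule, identically zero near the pole, compactly supported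
because `θ` vanishes near `c`). [folklore] -/
theorem isTestFunctionOn_comp_inversion {c : EuclideanSpace ℝ (Fin 2)} {θ : EuclideanSpace ℝ (Fin 2) → ℝ}
    (hθ : IsTestFunctionOn ⟨{c}ᶜ, isOpen_compl_singleton⟩ θ) :
    IsTestFunctionOn ⟨{c}ᶜ, isOpen_compl_singleton⟩ (fun x => θ (inversion c 1 x)) := by
  obtain ⟨ε, hε, hnear⟩ := comp_inversion_eq_zero_near hθ
  obtain ⟨R, hR, hfar⟩ := comp_inversion_eq_zero_far hθ
  have hzero : ∀ x, dist x c < ε → (fun x => θ (inversion c 1 x)) =ᶠ[𝓝 x] fun _ => 0 := fun x hx =>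
    Filter.eventually_of_mem (isOpen_ball.mem_nhds (mem_ball.2 hx)) fun y hy => hnear y (mem_ball.1 hy)
  refine ⟨?_, ?_, ?_⟩
  · rw [contDiff_iff_contDiffAt]
    intro x
    by_cases hx : dist x c < ε
    · exact (contDiffAt_const (c := (0 : ℝ))).congr_of_eventuallyEq (hzero x hx)
    · have hxc : x ≠ c := fun h => hx (by rw [h, dist_self]; exact hε)
      exact hθ.contDiff.contDiffAt.comp x (contDiffAt_const.inversion contDiffAt_const contDiffAt_id hxc)
  · refine HasCompactSupport.intro (isCompact_closedBall c R) fun x hx => hfar x ?_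
    rw [mem_closedBall, not_le] at hx
    exact hx
  · intro x hx hxc
    have h0 : x ∉ tsupport fun x => θ (inversion c 1 x) :=
      notMem_tsupport_iff_eventuallyEq.2 (hzero x (by rw [show x = c from hxc, dist_self]; exact hε))
    exact h0 hx

/-- Products of a test function on `{c}ᶜ` with a function smooth off the pole are test functions
on `{c}ᶜ`. [folklore] -/
theorem isTestFunctionOn_mul {c : EuclideanSpace ℝ (Fin 2)} {η w : EuclideanSpace ℝ (Fin 2) → ℝ}
    (hη : IsTestFunctionOn ⟨{c}ᶜ, isOpen_compl_singleton⟩ η) (hw : ∀ x, x ≠ c → ContDiffAt ℝ ∞ w x) :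
    IsTestFunctionOn ⟨{c}ᶜ, isOpen_compl_singleton⟩ (fun x => w x * η x) := by
  refine ⟨?_, hη.hasCompactSupport.mul_left, (tsupport_mul_subset_right (f := w) (g := η)).trans
    hη.tsupport_subset⟩
  rw [contDiff_iff_contDiffAt]
  intro x
  by_cases hx : x ∈ tsupport η
  · exact (hw x (fun h => hη.tsupport_subset hx h)).mul hη.contDiff.contDiffAt
  · have h0 : (fun x => w x * η x) =ᶠ[𝓝 x] fun _ => 0 := by
      filter_upwards [notMem_tsupport_iff_eventuallyEq.1 hx] with y hy
      simp [hy]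
    exact (contDiffAt_const (c := (0 : ℝ))).congr_of_eventuallyEq h0

/-- Integrability of `κ • f` on the whole plane for `κ` continuous, compactly supported in `Ω`,
and `f` locally integrable on `Ω`. [folklore] -/
theorem integrable_smul_of_locallyIntegrableOn {G : Type*} [NormedAddCommGroup G] [NormedSpace ℝ G]
    {Ω : Opens (EuclideanSpace ℝ (Fin 2))} {f : EuclideanSpace ℝ (Fin 2) → G}
    (hf : LocallyIntegrableOn f (Ω : Set (EuclideanSpace ℝ (Fin 2))) volume) {κ : EuclideanSpace ℝ (Fin 2) → ℝ}
    (hκ : Continuous κ) (hκs : HasCompactSupport κ) (hκΩ : tsupport κ ⊆ (Ω : Set (EuclideanSpace ℝ (Fin 2)))) :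
    Integrable (fun x => κ x • f x) := by
  have hK : IntegrableOn (fun x => κ x • f x) (tsupport κ) volume :=
    (hf.integrableOn_compact_subset hκΩ hκs).continuousOn_smul hκ.continuousOn hκs
  rw [← integrableOn_univ]
  refine hK.of_forall_sdiff_eq_zero MeasurableSet.univ fun x hx => ?_
  rw [image_eq_zero_of_notMem_tsupport hx.2, zero_smul]

/-- Directional derivatives of test functions are test functions (on the same open set). [folklore] -/
theorem isTestFunctionOn_fderiv_apply {Ω : Opens (EuclideanSpace ℝ (Fin 2))} {η : EuclideanSpace ℝ (Fin 2) → ℝ}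
    (hη : IsTestFunctionOn Ω η) (v : EuclideanSpace ℝ (Fin 2)) :
    IsTestFunctionOn Ω (fun x => fderiv ℝ η x v) :=
  ⟨(hη.contDiff.fderiv_right (m := ∞) (by simp)).clm_apply contDiff_const,
    hη.hasCompactSupport.fderiv_apply (𝕜 := ℝ) v,
    (tsupport_fderiv_apply_subset ℝ v).trans hη.tsupport_subset⟩

/-- Test functions on `{c}ᶜ` paired with a function locally integrable on `{c}ᶜ` are integrable on
the plane. [folklore] -/
theorem integrable_testFunction_mul {c : EuclideanSpace ℝ (Fin 2)} {f : EuclideanSpace ℝ (Fin 2) → ℝ}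
    (hf : LocallyIntegrableOn f ({c}ᶜ : Set (EuclideanSpace ℝ (Fin 2))) volume)
    {κ : EuclideanSpace ℝ (Fin 2) → ℝ} (hκ : IsTestFunctionOn ⟨{c}ᶜ, isOpen_compl_singleton⟩ κ) :
    Integrable (fun x => κ x * f x) :=
  integrable_smul_of_locallyIntegrableOn (Ω := ⟨{c}ᶜ, isOpen_compl_singleton⟩) hf hκ.contDiff.continuous
    hκ.hasCompactSupport hκ.tsupport_subset

/-! ## §2 The weak chain rule off the pole -/

/-- The inversion is continuous off the pole. [folklore] -/
theorem continuousOn_inversion (c : EuclideanSpace ℝ (Fin 2)) :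
    ContinuousOn (inversion c (1 : ℝ)) ({c}ᶜ : Set (EuclideanSpace ℝ (Fin 2))) := fun _ hx =>
  (contDiffAt_const.inversion contDiffAt_const contDiffAt_id hx (n := 1)).continuousAt.continuousWithinAt

/-- `x ↦ DM(x)` is continuous off the pole. [folklore] -/
theorem continuousOn_fderiv_inversion (c : EuclideanSpace ℝ (Fin 2)) :
    ContinuousOn (fderiv ℝ (inversion c (1 : ℝ))) ({c}ᶜ : Set (EuclideanSpace ℝ (Fin 2))) := fun _ hx =>
  ((contDiffAt_const.inversion contDiffAt_const contDiffAt_id hx (n := 1)).continuousAt_fderiv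
    (by simp)).continuousWithinAt

/-- Compact subsets of `{c}ᶜ` are carried to compact subsets of `{c}ᶜ`, and back. [folklore] -/
theorem image_inversion_compact {c : EuclideanSpace ℝ (Fin 2)} {T : Set (EuclideanSpace ℝ (Fin 2))}
    (hT : T ⊆ {c}ᶜ) (hTc : IsCompact T) :
    IsCompact (inversion c 1 '' T) ∧ inversion c 1 '' T ⊆ {c}ᶜ ∧ inversion c 1 '' (inversion c 1 '' T) = T := by
  refine ⟨hTc.image_of_continuousOn ((continuousOn_inversion c).mono hT), ?_, ?_⟩
  · rintro _ ⟨x, hx, rfl⟩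
    exact inversion_ne_center (hT hx)
  · rw [Set.image_image]
    simp

/-- **Local integrability transports**: `u ∘ M` is locally integrable on `{c}ᶜ` if `u` is
(change of variables on compact pieces, the Jacobian being bounded there). [folklore] -/
theorem locallyIntegrableOn_comp_inversion {G : Type*} [NormedAddCommGroup G] [NormedSpace ℝ G]
    {c : EuclideanSpace ℝ (Fin 2)} {u : EuclideanSpace ℝ (Fin 2) → G}
    (hu : LocallyIntegrableOn u ({c}ᶜ : Set (EuclideanSpace ℝ (Fin 2))) volume) :
    LocallyIntegrableOn (fun y => u (inversion c 1 y)) ({c}ᶜ : Set (EuclideanSpace ℝ (Fin 2))) volume := by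
  rw [locallyIntegrableOn_iff isOpen_compl_singleton.isLocallyClosed]
  intro T hT hTc
  obtain ⟨hKc, hKsub, hKT⟩ := image_inversion_compact hT hTc
  set K := inversion c 1 '' T with hK
  have huK : IntegrableOn u K volume := hu.integrableOn_compact_subset hKsub hKc
  have hJ : ContinuousOn (fun x : EuclideanSpace ℝ (Fin 2) => ((‖x - c‖ ^ 2)⁻¹) ^ 2) K := by
    refine ContinuousOn.pow (ContinuousOn.inv₀ (by fun_prop) fun x hx => ?_) 2
    exact pow_ne_zero 2 (norm_ne_zero_iff.2 (sub_ne_zero.2 (hKsub hx)))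
  have h1 : IntegrableOn (fun x => (((‖x - c‖ ^ 2)⁻¹) ^ 2) • u x) K volume := huK.continuousOn_smul hJ hKc
  have hd : ∀ x ∈ K, HasFDerivWithinAt (inversion c 1) (fderiv ℝ (inversion c 1) x) K x := fun x hx =>
    ((hasFDerivAt_inversion (R := 1) (hKsub hx)).differentiableAt.hasFDerivAt).hasFDerivWithinAt
  have key := (integrableOn_image_iff_integrableOn_abs_det_fderiv_smul volume hKc.measurableSet hd
    ((inversion_injective c one_ne_zero).injOn) (fun y => u (inversion c 1 y))).2 ?_
  · rwa [hKT] at key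
  · refine h1.congr_fun (fun x hx => ?_) hKc.measurableSet
    simp only [abs_det_fderiv_inversion (hKsub hx), inversion_inversion_one]

/-- **Local integrability of the transported derivative**: `y ↦ Gu (M y) ∘L DM(y)` is locally
integrable on `{c}ᶜ` if `Gu` is. [folklore] -/
theorem locallyIntegrableOn_comp_inversion_fderiv {G : Type*} [NormedAddCommGroup G] [NormedSpace ℝ G]
    {c : EuclideanSpace ℝ (Fin 2)} {Gu : EuclideanSpace ℝ (Fin 2) → EuclideanSpace ℝ (Fin 2) →L[ℝ] G}
    (hG : LocallyIntegrableOn Gu ({c}ᶜ : Set (EuclideanSpace ℝ (Fin 2))) volume) :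
    LocallyIntegrableOn (fun y => (Gu (inversion c 1 y)).comp (fderiv ℝ (inversion c 1) y))
      ({c}ᶜ : Set (EuclideanSpace ℝ (Fin 2))) volume := by
  -- first transport `Gu` itself, then compose with the continuous `DM` on `{c}ᶜ`
  have h1 : LocallyIntegrableOn (fun y => Gu (inversion c 1 y)) ({c}ᶜ : Set (EuclideanSpace ℝ (Fin 2))) volume :=
    locallyIntegrableOn_comp_inversion hG
  rw [locallyIntegrableOn_iff isOpen_compl_singleton.isLocallyClosed] at h1 ⊢
  intro T hT hTc
  have hi := h1 T hT hTc
  -- `DM` is bounded on `T`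
  have hDc : ContinuousOn (fderiv ℝ (inversion c (1 : ℝ))) T := (continuousOn_fderiv_inversion c).mono hT
  obtain ⟨C, hC⟩ := hTc.exists_bound_of_continuousOn hDc
  refine Integrable.mono' (hi.norm.const_mul C) ?_ ?_
  · exact (ContinuousLinearMap.compL ℝ (EuclideanSpace ℝ (Fin 2)) (EuclideanSpace ℝ (Fin 2)) G).aestronglyMeasurable_comp₂
      hi.aestronglyMeasurable (hDc.aestronglyMeasurable hTc.measurableSet)
  · filter_upwards [ae_restrict_mem hTc.measurableSet] with y hy
    calc ‖(Gu (inversion c 1 y)).comp (fderiv ℝ (inversion c 1) y)‖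
        ≤ ‖Gu (inversion c 1 y)‖ * ‖fderiv ℝ (inversion c 1) y‖ := ContinuousLinearMap.opNorm_comp_le _ _
      _ ≤ ‖Gu (inversion c 1 y)‖ * C := by gcongr; exact hC y hy
      _ = C * ‖Gu (inversion c 1 y)‖ := mul_comm _ _

/-- The coefficient fields `Wᵢ(x) = (DM(x) v)ᵢ` of part 1, their smoothness and that of their
partial derivatives off the pole (packaged for the test-function lemmas). [folklore] -/
theorem contDiffAt_fderiv_inversionField_coord {c x : EuclideanSpace ℝ (Fin 2)} (hx : x ≠ c)
    (v : EuclideanSpace ℝ (Fin 2)) (i : Fin 2) (e : EuclideanSpace ℝ (Fin 2)) :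
    ContDiffAt ℝ ∞ (fun y => fderiv ℝ (fun y : EuclideanSpace ℝ (Fin 2) =>
        (‖y - c‖ ^ 2)⁻¹ * v i - 2 * ⟪y - c, v⟫ * ((‖y - c‖ ^ 2)⁻¹) ^ 2 * (y - c) i) y e) x :=
  ((contDiffAt_inversionField_coord hx v i (n := ∞)).fderiv_right (m := ∞) (by simp)).clm_apply
    contDiffAt_const

/-- **One coordinate of the integration by parts through the inversion**: with
`Wᵢ(x) = (DM(x) v)ᵢ`, `η = θ ∘ M` and `u` weakly differentiable on `{c}ᶜ`,
`∫ Wᵢ ∂ᵢη · u = −∫ Wᵢ η · Gu(·)(eᵢ) − ∫ (∂ᵢWᵢ) η · u` (the weak derivative of `u` tested against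
the test function `Wᵢ η`, and the product rule). [folklore] -/
theorem integral_coord_mul_fderiv_mul {c : EuclideanSpace ℝ (Fin 2)} {u : EuclideanSpace ℝ (Fin 2) → ℝ}
    {Gu : EuclideanSpace ℝ (Fin 2) → EuclideanSpace ℝ (Fin 2) →L[ℝ] ℝ}
    (hu : HasWeakFDerivOn ⟨{c}ᶜ, isOpen_compl_singleton⟩ volume u Gu)
    {η : EuclideanSpace ℝ (Fin 2) → ℝ} (hη : IsTestFunctionOn ⟨{c}ᶜ, isOpen_compl_singleton⟩ η)
    (v : EuclideanSpace ℝ (Fin 2)) (i : Fin 2) :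
    ∫ x, ((‖x - c‖ ^ 2)⁻¹ * v i - 2 * ⟪x - c, v⟫ * ((‖x - c‖ ^ 2)⁻¹) ^ 2 * (x - c) i) *
        fderiv ℝ η x (EuclideanSpace.single i 1) * u x =
      -(∫ x, ((‖x - c‖ ^ 2)⁻¹ * v i - 2 * ⟪x - c, v⟫ * ((‖x - c‖ ^ 2)⁻¹) ^ 2 * (x - c) i) * η x *
          Gu x (EuclideanSpace.single i 1))
      - ∫ x, fderiv ℝ (fun y : EuclideanSpace ℝ (Fin 2) =>
          (‖y - c‖ ^ 2)⁻¹ * v i - 2 * ⟪y - c, v⟫ * ((‖y - c‖ ^ 2)⁻¹) ^ 2 * (y - c) i) x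
            (EuclideanSpace.single i 1) * η x * u x := by
  set W : EuclideanSpace ℝ (Fin 2) → ℝ := fun x =>
    (‖x - c‖ ^ 2)⁻¹ * v i - 2 * ⟪x - c, v⟫ * ((‖x - c‖ ^ 2)⁻¹) ^ 2 * (x - c) i with hW
  have hWs : ∀ x, x ≠ c → ContDiffAt ℝ ∞ W x := fun x hx => contDiffAt_inversionField_coord hx v i
  have hW's : ∀ x, x ≠ c → ContDiffAt ℝ ∞ (fun y => fderiv ℝ W y (EuclideanSpace.single i 1)) x :=
    fun x hx => contDiffAt_fderiv_inversionField_coord hx v i _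
  -- the three test functions on `{c}ᶜ`
  have hT1 : IsTestFunctionOn ⟨{c}ᶜ, isOpen_compl_singleton⟩ (fun x => W x * η x) := isTestFunctionOn_mul hη hWs
  have hT2 : IsTestFunctionOn ⟨{c}ᶜ, isOpen_compl_singleton⟩
      (fun x => W x * fderiv ℝ η x (EuclideanSpace.single i 1)) :=
    isTestFunctionOn_mul (isTestFunctionOn_fderiv_apply hη _) hWs
  have hT3 : IsTestFunctionOn ⟨{c}ᶜ, isOpen_compl_singleton⟩
      (fun x => fderiv ℝ W x (EuclideanSpace.single i 1) * η x) := isTestFunctionOn_mul hη hW's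
  have hT4 : IsTestFunctionOn ⟨{c}ᶜ, isOpen_compl_singleton⟩
      (fun x => fderiv ℝ (fun x => W x * η x) x (EuclideanSpace.single i 1)) := isTestFunctionOn_fderiv_apply hT1 _
  -- integrability of the three pairings
  have hI2 := integrable_testFunction_mul hu.locallyIntegrableOn hT2
  have hI3 := integrable_testFunction_mul hu.locallyIntegrableOn hT3
  have hI4 := integrable_testFunction_mul hu.locallyIntegrableOn hT4
  -- product rule, a.e. (off the pole)
  have hprod : (fun x => W x * fderiv ℝ η x (EuclideanSpace.single i 1) * u x) =ᵐ[volume]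
      fun x => fderiv ℝ (fun x => W x * η x) x (EuclideanSpace.single i 1) * u x -
        fderiv ℝ W x (EuclideanSpace.single i 1) * η x * u x := by
    filter_upwards [Measure.ae_ne volume c] with x hx
    have hWd : DifferentiableAt ℝ W x := (hWs x hx).differentiableAt (by simp)
    have hηd : DifferentiableAt ℝ η x := hη.contDiff.differentiable (by simp) x
    rw [fderiv_fun_mul hWd hηd]
    simp only [_root_.add_apply, _root_.smul_apply, smul_eq_mul]
    ring
  rw [integral_congr_ae hprod, integral_sub hI4 hI3]
  -- the weak derivative of `u` tested against `W η`
  have key := hu.integral_fderiv_smul_eq _ (EuclideanSpace.single i 1) hT1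
  simp only [Opens.coe_mk, restrict_compl_singleton, smul_eq_mul] at key
  rw [key]

/-- **The integration-by-parts identity through the inversion** (the heart of W-INV): for `u` with
weak derivative `Gu` on `{c}ᶜ`, a test function `θ` on `{c}ᶜ` and a direction `v`,
`∫ ∂_v θ · (u ∘ M) = −∫ θ · Gu(M ·)(DM(·) v)`.  Proof: change variables `y = M x` on both sides;
`‖x−c‖⁻⁴ ∂_vθ(M x) = ∂_{DM(x) v}(θ ∘ M)(x) = Σᵢ (DM(x) v)ᵢ ∂ᵢ(θ∘M)(x)`; integrate the weak derivative
of `u` against the test functions `(DM(·) v)ᵢ · (θ ∘ M)`; the zeroth-order terms add up to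
`(div DM(·) v) · (θ∘M) · u = 0` by the harmonicity of the planar inversion.
[cite: BrezisCoron1985, Appendix p. 48 (inversion step)] -/
theorem integral_fderiv_mul_comp_inversion {c : EuclideanSpace ℝ (Fin 2)} {u : EuclideanSpace ℝ (Fin 2) → ℝ}
    {Gu : EuclideanSpace ℝ (Fin 2) → EuclideanSpace ℝ (Fin 2) →L[ℝ] ℝ}
    (hu : HasWeakFDerivOn ⟨{c}ᶜ, isOpen_compl_singleton⟩ volume u Gu)
    {θ : EuclideanSpace ℝ (Fin 2) → ℝ} (hθ : IsTestFunctionOn ⟨{c}ᶜ, isOpen_compl_singleton⟩ θ)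
    (v : EuclideanSpace ℝ (Fin 2)) :
    ∫ y, (fderiv ℝ θ y v) * u (inversion c 1 y) =
      -∫ y, θ y * Gu (inversion c 1 y) (fderiv ℝ (inversion c 1) y v) := by
  have hηt : IsTestFunctionOn ⟨{c}ᶜ, isOpen_compl_singleton⟩ (fun x => θ (inversion c 1 x)) :=
    isTestFunctionOn_comp_inversion hθ
  set W : Fin 2 → EuclideanSpace ℝ (Fin 2) → ℝ := fun i x =>
    (‖x - c‖ ^ 2)⁻¹ * v i - 2 * ⟪x - c, v⟫ * ((‖x - c‖ ^ 2)⁻¹) ^ 2 * (x - c) i with hW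
  -- (1) change of variables on the left
  have hL : ∫ y, (fderiv ℝ θ y v) * u (inversion c 1 y) =
      ∫ x, (((‖x - c‖ ^ 2)⁻¹) ^ 2) • ((fderiv ℝ θ (inversion c 1 x) v) * u x) := by
    have h := integral_comp_inversion' c (fun x => (fderiv ℝ θ (inversion c 1 x) v) * u x)
    simpa only [inversion_inversion_one] using h
  -- (2) pointwise off the pole: `‖x-c‖⁻⁴ ∂_vθ(Mx) = Σ_i W i x * ∂_i(θ∘M) x`
  have hpt : ∀ x, x ≠ c → (((‖x - c‖ ^ 2)⁻¹) ^ 2) * fderiv ℝ θ (inversion c 1 x) v =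
      ∑ i : Fin 2, W i x * fderiv ℝ (fun y => θ (inversion c 1 y)) x (EuclideanSpace.single i 1) := by
    intro x hx
    have hθd : DifferentiableAt ℝ θ (inversion c 1 x) := hθ.contDiff.differentiable (by simp) _
    rw [fderiv_comp_inversion_apply hx hθd, ← smul_eq_mul, ← map_smul,
      sq_smul_fderiv_inversion_inversion_apply hx,
      clm_apply_eq_sum (fderiv ℝ (fun y => θ (inversion c 1 y)) x)]
    refine Finset.sum_congr rfl fun i _ => ?_
    rw [smul_eq_mul, fderiv_inversion_apply_coord hx]
  -- (3) the left integral, coordinate by coordinate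
  have hT2 : ∀ i, IsTestFunctionOn ⟨{c}ᶜ, isOpen_compl_singleton⟩
      (fun x => W i x * fderiv ℝ (fun y => θ (inversion c 1 y)) x (EuclideanSpace.single i 1)) := fun i =>
    isTestFunctionOn_mul (isTestFunctionOn_fderiv_apply hηt _) fun x hx => contDiffAt_inversionField_coord hx v i
  have hL' : ∫ x, (((‖x - c‖ ^ 2)⁻¹) ^ 2) • ((fderiv ℝ θ (inversion c 1 x) v) * u x) =
      ∑ i : Fin 2, ∫ x, W i x * fderiv ℝ (fun y => θ (inversion c 1 y)) x (EuclideanSpace.single i 1) * u x := by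
    rw [← integral_finsetSum _ fun i _ => integrable_testFunction_mul hu.locallyIntegrableOn (hT2 i)]
    refine integral_congr_ae ?_
    filter_upwards [Measure.ae_ne volume c] with x hx
    rw [smul_eq_mul, ← mul_assoc, hpt x hx, Finset.sum_mul]
  -- (4) each coordinate by the weak derivative of `u`; the divergence terms
  have hT3 : ∀ i, IsTestFunctionOn ⟨{c}ᶜ, isOpen_compl_singleton⟩
      (fun x => fderiv ℝ (W i) x (EuclideanSpace.single i 1) * θ (inversion c 1 x)) := fun i =>
    isTestFunctionOn_mul hηt fun x hx => contDiffAt_fderiv_inversionField_coord hx v i _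
  have hT1 : ∀ i, IsTestFunctionOn ⟨{c}ᶜ, isOpen_compl_singleton⟩
      (fun x => W i x * θ (inversion c 1 x)) := fun i =>
    isTestFunctionOn_mul hηt fun x hx => contDiffAt_inversionField_coord hx v i
  have hdiv : ∑ i : Fin 2, ∫ x, fderiv ℝ (W i) x (EuclideanSpace.single i 1) * θ (inversion c 1 x) * u x = 0 := by
    rw [← integral_finsetSum _ fun i _ => integrable_testFunction_mul hu.locallyIntegrableOn (hT3 i)]
    refine (integral_congr_ae ?_).trans (integral_zero _ _)
    filter_upwards [Measure.ae_ne volume c] with x hx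
    rw [← Finset.sum_mul, ← Finset.sum_mul, sum_fderiv_inversionField_coord_eq_zero hx v]
    ring
  have hmain : ∑ i : Fin 2, ∫ x, W i x * fderiv ℝ (fun y => θ (inversion c 1 y)) x (EuclideanSpace.single i 1) * u x =
      -∫ x, θ (inversion c 1 x) * ∑ i : Fin 2, W i x * Gu x (EuclideanSpace.single i 1) := by
    have step : ∀ i : Fin 2, ∫ x, W i x * fderiv ℝ (fun y => θ (inversion c 1 y)) x (EuclideanSpace.single i 1) * u x =
        -(∫ x, W i x * θ (inversion c 1 x) * Gu x (EuclideanSpace.single i 1))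
        - ∫ x, fderiv ℝ (W i) x (EuclideanSpace.single i 1) * θ (inversion c 1 x) * u x := fun i =>
      integral_coord_mul_fderiv_mul hu hηt v i
    have hI1 : ∀ i : Fin 2, Integrable (fun x => W i x * θ (inversion c 1 x) * Gu x (EuclideanSpace.single i 1)) := by
      intro i
      have h := integrable_testFunction_mul ((ContinuousLinearMap.apply ℝ ℝ
        (EuclideanSpace.single i (1 : ℝ))).locallyIntegrableOn_comp hu.locallyIntegrableOn_deriv) (hT1 i)
      refine h.congr (Eventually.of_forall fun x => ?_)
      simp only [Function.comp_apply, ContinuousLinearMap.apply_apply]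
    simp_rw [step]
    rw [Finset.sum_sub_distrib, hdiv, sub_zero, Finset.sum_neg_distrib, ← integral_finsetSum _ fun i _ => hI1 i]
    congr 1
    refine integral_congr_ae (Eventually.of_forall fun x => ?_)
    dsimp only
    rw [Finset.mul_sum]
    refine Finset.sum_congr rfl fun i _ => ?_
    ring
  -- (5) `Σ_i W i x * Gu x (e i) = Gu x (DM(x) v)` off the pole
  have hsum : ∀ x, x ≠ c → ∑ i : Fin 2, W i x * Gu x (EuclideanSpace.single i 1) =
      Gu x (fderiv ℝ (inversion c 1) x v) := by
    intro x hx
    rw [clm_apply_eq_sum (Gu x)]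
    refine Finset.sum_congr rfl fun i _ => ?_
    rw [smul_eq_mul, fderiv_inversion_apply_coord hx]
  -- (6) change of variables on the right
  have hR : ∫ y, θ y * Gu (inversion c 1 y) (fderiv ℝ (inversion c 1) y v) =
      ∫ x, θ (inversion c 1 x) * Gu x (fderiv ℝ (inversion c 1) x v) := by
    have h := integral_comp_inversion' c
      (fun x => θ (inversion c 1 x) * Gu x (fderiv ℝ (inversion c 1) (inversion c 1 x) v))
    simp only [inversion_inversion_one] at h
    rw [h]
    refine integral_congr_ae ?_
    filter_upwards [Measure.ae_ne volume c] with x hx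
    rw [smul_eq_mul, ← sq_smul_fderiv_inversion_inversion_apply hx v, map_smul, smul_eq_mul]
    ring
  rw [hL, hL', hmain, hR]
  congr 1
  refine integral_congr_ae ?_
  filter_upwards [Measure.ae_ne volume c] with x hx
  rw [hsum x hx]

/-- **Weak chain rule under the planar inversion (off the pole)**: if `u` has the weak derivative
`Gu` on `{c}ᶜ`, then `u ∘ M` has the weak derivative `y ↦ Gu (M y) ∘L DM(y)` on `{c}ᶜ`.
[cite: BrezisCoron1985, Appendix p. 48 (inversion step)] -/
theorem hasWeakFDerivOn_comp_inversion {c : EuclideanSpace ℝ (Fin 2)} {u : EuclideanSpace ℝ (Fin 2) → ℝ}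
    {Gu : EuclideanSpace ℝ (Fin 2) → EuclideanSpace ℝ (Fin 2) →L[ℝ] ℝ}
    (hu : HasWeakFDerivOn ⟨{c}ᶜ, isOpen_compl_singleton⟩ volume u Gu) :
    HasWeakFDerivOn ⟨{c}ᶜ, isOpen_compl_singleton⟩ volume (fun y => u (inversion c 1 y))
      (fun y => (Gu (inversion c 1 y)).comp (fderiv ℝ (inversion c 1) y)) := by
  refine ⟨locallyIntegrableOn_comp_inversion hu.locallyIntegrableOn,
    locallyIntegrableOn_comp_inversion_fderiv hu.locallyIntegrableOn_deriv, fun θ v hθ => ?_⟩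
  simp only [Opens.coe_mk, restrict_compl_singleton, smul_eq_mul, ContinuousLinearMap.comp_apply]
  exact integral_fderiv_mul_comp_inversion hu hθ v

end Summit.QuantumFields.YangMills.Theorems.PoincareLipschitzSobolevInversion

end
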